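import Summits.ABC.ABC.Theorems.CuspFieldPencilGoldenCuspShadow
import Summits.ABC.ABC.Theorems.CuspFieldPencilNFPencilOfScoones
import Literature.NumberTheory.DiophantineGeometry.MatveevYuPlaceBoundsNumberField
import Literature.NumberTheory.DiophantineGeometry.AbcTwoAdicValuationProofs
import HarnessLib

/-!
# STUB-IDEAS `stub_conjugateCuspTriple` — ideator k=1, GEN 9 (FAMILY 1: RECOGNISE & IMPORT) — typed helper statements

Crux stmt-ABC-26026 `CuspFieldPencil.GoldenCuspShadow` is CLOSED (proved by
`Summit.ABC.ABC.Theorems.goldenCuspShadow_proof`, 2026-08-31T20:40:01Z); the stub is moot for `closes`.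
FAMILY-1 content of this sketch (statements only; bodies `sorry` — stub-ideation does not prove):
* **I1 (import, 0 open lemmas)**: the stub text `Sig` is the `K = ℚ(√5)`, `k = 3` instance of Scoones 2023 Thm 3,
  i.e. LANDED `Summit.ABC.ABC.Theorems.nfPencilBound_of_scoones2021` composed with the SORRY-FREE committed
  workfile lemma `SideaK2G8.sig_of_nfPencilBound` (restated here as `sig_of_nfPencilBound`); `sig_of_scoones2021` is
  the kernel-checked composition BY NAME.
* **I2 (import for the standard-facts road)**: the cost-unit absorption `A·C^{ω(n)}·∏_{p∣n} log p ≤ C'·rad(n)^η` is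
  two LANDED Literature lemmas (`exists_pow_card_primeFactors_le_mul_rpow`, `exists_prod_log_primeFactors_le_mul_rpow`)
  — equivalently the landed receipt `SingleTowerSzpiroLine.exists_prod_mul_log_div_rpow_le` used by the landed
  `GoldenCuspShadowBaker.theta_call_le`.
* the (η, A)-currency interface `QArch`/`QFin`/`QPre` of the Matveev/Yu road, whose endgame is the landed
  `GoldenCuspShadowBaker.endgame_abstract` verbatim (k2-g9 `SideaK2G9.qSideRad_of_preQ` PROVES the clone; cited, not redone).
`Q = u² − 11uw − w²`, `R = rad(uwQ)`, `H = max(|u|,|w|)`, `y = log 13 + 2 log H`, `L = log max(e, 2y)`.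
-/

set_option linter.dupNamespace false

noncomputable section

open Real
open Literature.NumberTheory.DiophantineGeometry
open Literature.NumberTheory.DiophantineGeometry.Dioph

namespace Summit.ABC.ABC.Cruxes.GoldenCuspShadow.SideaK1G9

/-- The registered stub `stub_conjugateCuspTriple`, verbatim. -/
def Sig : Prop :=
  ∀ ε : ℝ, 0 < ε → ∃ κ : ℝ, ∀ u w : ℤ, IsCoprime u w → u * w * (u ^ 2 - 11 * u * w - w ^ 2) ≠ 0 → Real.log (max (|(u : ℝ)|) (|(w : ℝ)|)) ≤ κ * (((UniqueFactorizationMonoid.radical (u * w * (u ^ 2 - 11 * u * w - w ^ 2))).natAbs : ℕ) : ℝ) ^ (ε : ℝ) * ((((UniqueFactorizationMonoid.radical (u ^ 2 - 11 * u * w - w ^ 2)).natAbs : ℕ) : ℝ) ^ (2 / 3 : ℝ) * (min (((UniqueFactorizationMonoid.radical u).natAbs : ℕ) : ℝ) (((UniqueFactorizationMonoid.radical w).natAbs : ℕ) : ℝ)) ^ (2 / 3 : ℝ))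

/-! ## I1 — the stub is an INSTANCE of a landed bridge (Family 1: recognise & import) -/

/-- **I1 [0 open]** `NFPencilBound → Sig`: PROVED sorry-free as
`Summit.ABC.ABC.Cruxes.GoldenCuspShadow.SideaK2G8.sig_of_nfPencilBound` (committed crux workfile
`STUB_IDEAS_stub_conjugateCuspTriple_2_g8_Sketch.lean`, commit 3a68f1d3d4c4): `k = 3` sub-pencil `(w, x₊, x₋)` of the
golden pencil in `𝓞_{ℚ(√5)}`, `G_w ≤ rad(w)²`, `G₊G₋ ≤ 125·rad(Q)²`, symmetric in `u ↔ w` via the landed `cuspMinRadBound_holds`.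
Restated here only so that the import composition below is kernel-checked by name. -/
theorem sig_of_nfPencilBound (h : Summit.ABC.ABC.Theses.CuspFieldPencil.NFPencilBound) : Sig := by
  sorry

/-- **I1, composed [kernel-checked modulo the body above]**: `Sig` modulo the Scoones fact = LANDED
`Summit.ABC.ABC.Theorems.nfPencilBound_of_scoones2021` ∘ `sig_of_nfPencilBound`. Trust root: Scoones 2023 Thm 3
(arXiv:2111.07791 p. 4), itself proved in print from Matveev 2000 + Yu 2007. -/
theorem sig_of_scoones2021 (hS : scoones2021_abcNumberField_classNumberOne) : Sig :=
  sig_of_nfPencilBound (Summit.ABC.ABC.Theorems.nfPencilBound_of_scoones2021 hS)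

/-! ## I2 — the cost-unit absorption is LANDED (import for k2-g9 `memberT_le` / k3 Q4 / g7 T-bookkeeping) -/

/-- **I2 [XS glue over two landed lemmas]** `A·C^{ω(n)}·∏_{p∣n} log p ≤ C'·(∏_{p∣n} p)^η`:
`exists_pow_card_primeFactors_le_mul_rpow (K := C) (δ := η/2)` × `exists_prod_log_primeFactors_le_mul_rpow (δ := η/2)`
(both `Literature.NumberTheory.DiophantineGeometry`, file `AbcTwoAdicValuationProofs`), `rpow_add`; or in one step the landed
receipt `Summit.ABC.ABC.Theorems.SingleTowerSzpiroLine.exists_prod_mul_log_div_rpow_le (A := C)`, exactly as the landed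
`GoldenCuspShadowBaker.theta_call_le` consumes it. With `(∏_{p∣n} p : ℝ) = rad n` (`GoldenCuspShadowBaker.radR_prod`). -/
theorem cost_absorb {A C : ℝ} (hA : 0 ≤ A) (hC : 1 ≤ C) {η : ℝ} (hη : 0 < η) :
    ∃ C' : ℝ, 1 ≤ C' ∧ ∀ n : ℕ, n ≠ 0 →
      A * C ^ n.primeFactors.card * ∏ p ∈ n.primeFactors, Real.log (p : ℝ) ≤
        C' * (∏ p ∈ n.primeFactors, (p : ℝ)) ^ η := by
  sorry

/-! ## The (η, A)-currency interface of the Matveev/Yu road (endgame = landed `endgame_abstract`) -/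

/-- ARCHIMEDEAN HALF of the Q-side in FILE-C currency (`QArch`): `2 log H ≤ log|Q| + A_η · rad(uw)^η · L`.
Content: `|u| > 23|w| ⇒ |Q| ≥ u²/4` (no LFL); else `log|Q| = 2 log|w| + log|t − φ⁵| + log|t + φ⁻⁵|` (`t = u/w`) and
Matveev at a real place of `K = ℚ(√5)` (`Dioph.evertseGyory2022_prop_4_2_4_infinite_nf_of_matveev`, `d = 2`,
`α = (−1, θ, p ∣ uw)`, `b = (·, ∓5, v_p u − v_p w)`, `log B ≤ L`) bounds `−log|t·φ^{∓5} ∓… − 1|`; `c₁₀(n,2)·Ω ≤ A·rad(uw)^η`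
by `exists_pow_card_primeFactors_le_mul_rpow` / `exists_prod_log_primeFactors_le_mul_rpow`. (= k2-g7 H5 `fNotSmall`, k3 Q4.) -/
def QArch : Prop :=
  ∀ η : ℝ, 0 < η → ∃ A : ℝ, 1 ≤ A ∧ ∀ u w : ℤ, IsCoprime u w → u * w * (u ^ 2 - 11 * u * w - w ^ 2) ≠ 0 →
    2 * Real.log (max (|(u : ℝ)|) (|(w : ℝ)|)) ≤
      Real.log |(((u ^ 2 - 11 * u * w - w ^ 2 : ℤ)) : ℝ)| +
        A * (((UniqueFactorizationMonoid.radical (u * w)).natAbs : ℕ) : ℝ) ^ η *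
          Real.log (max (Real.exp 1) (2 * (Real.log 13 + 2 * Real.log (max (|(u : ℝ)|) (|(w : ℝ)|)))))

/-- FINITE HALF of the Q-side, FINE (degree-one) cost (`QFin`): `log|Q| ≤ A_η · rad(uw)^η · rad(Q) · L`.
Content: for `p ∣ Q` pick a prime `𝔭 ∋ p` of `𝓞_K` with `N𝔭 = p` (k2-g7 N1–N5, PROVED: every `𝔭 ∋ p`, `p ∣ Q`, has
`N𝔭 = p`), `v_p(Q) log p ≤ ord_𝔭(x₊x₋) log N𝔭 = −log|Λ₊|_𝔭 − log|Λ₋|_𝔭`, Yu at `𝔭`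
(`Dioph.evertseGyory2022_prop_4_2_4_finite_nf_of_yu`, `N𝔭/log N𝔭 ≤ p/log 2`), then `Σ_{p∣Q} p ≤ rad Q`.
(= k2-g7 H8f `fUpper_fine`; crude variant with `rad(Q)²`: k3-g4 Y2/Y5 — enough for `Sig`, not for `GoldenThird`.) -/
def QFin : Prop :=
  ∀ η : ℝ, 0 < η → ∃ A : ℝ, 1 ≤ A ∧ ∀ u w : ℤ, IsCoprime u w → u * w * (u ^ 2 - 11 * u * w - w ^ 2) ≠ 0 →
    Real.log |(((u ^ 2 - 11 * u * w - w ^ 2 : ℤ)) : ℝ)| ≤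
      A * (((UniqueFactorizationMonoid.radical (u * w)).natAbs : ℕ) : ℝ) ^ η *
        (((UniqueFactorizationMonoid.radical (u ^ 2 - 11 * u * w - w ^ 2)).natAbs : ℕ) : ℝ) *
          Real.log (max (Real.exp 1) (2 * (Real.log 13 + 2 * Real.log (max (|(u : ℝ)|) (|(w : ℝ)|)))))

/-- The Q-side PRE-BOUND in the exact shape consumed by the landed `GoldenCuspShadowBaker.endgame_abstract`
(compare the landed `GoldenCuspShadowBaker.pre_routeU`, with `rad u` replaced by `rad Q`). -/
def QPre : Prop :=
  ∀ η : ℝ, 0 < η → ∃ A : ℝ, ∀ u w : ℤ, IsCoprime u w → u * w * (u ^ 2 - 11 * u * w - w ^ 2) ≠ 0 →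
    Real.log 13 + 2 * Real.log (max (|(u : ℝ)|) (|(w : ℝ)|)) ≤
      A * (((UniqueFactorizationMonoid.radical (u * w * (u ^ 2 - 11 * u * w - w ^ 2))).natAbs : ℕ) : ℝ) ^ η *
        (((UniqueFactorizationMonoid.radical (u ^ 2 - 11 * u * w - w ^ 2)).natAbs : ℕ) : ℝ) *
          Real.log (max (Real.exp 1) (2 * (Real.log 13 + 2 * Real.log (max (|(u : ℝ)|) (|(w : ℝ)|)))))

/-- The Q-member bound (`QSideRad`, k2-g7/g8 text): `log H ≤ κ_ε · R^ε · rad(Q)`. -/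
def QSideRad : Prop :=
  ∀ ε : ℝ, 0 < ε → ∃ κ : ℝ, ∀ u w : ℤ, IsCoprime u w → u * w * (u ^ 2 - 11 * u * w - w ^ 2) ≠ 0 →
    Real.log (max (|(u : ℝ)|) (|(w : ℝ)|)) ≤
      κ * (((UniqueFactorizationMonoid.radical (u * w * (u ^ 2 - 11 * u * w - w ^ 2))).natAbs : ℕ) : ℝ) ^ (ε : ℝ) *
        (((UniqueFactorizationMonoid.radical (u ^ 2 - 11 * u * w - w ^ 2)).natAbs : ℕ) : ℝ)

/-- By-product (`GoldenThird`, k2 text): exponent `1/3 + ε` on the 5-torsion cusp form. -/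
def GoldenThird : Prop :=
  ∀ ε : ℝ, 0 < ε → ∃ κ : ℝ, ∀ u w : ℤ, IsCoprime u w → u * w * (u ^ 2 - 11 * u * w - w ^ 2) ≠ 0 →
    Real.log (max (|(u : ℝ)|) (|(w : ℝ)|)) ≤
      κ * (((UniqueFactorizationMonoid.radical (u * w * (u ^ 2 - 11 * u * w - w ^ 2))).natAbs : ℕ) : ℝ) ^ (1 / 3 + ε : ℝ)

/-! ## Helper lemmas (one prover cycle each) -/

/-- **E1 [S]** pre-bound from the two halves: `y = log 13 + 2 log H ≤ log 13 + log|Q| + A₁ rad(uw)^η L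
≤ (log 13 + A₁ + A₂) · R^η · rad(Q) · L` (`1 ≤ L`, `1 ≤ rad`, `rad(uw) ≤ R`: `GoldenCuspShadowBaker.one_le_radR`,
`one_le_log_max_exp`, `radR_le_radR_prod`). -/
theorem qPre_of_halves (hA : QArch) (hF : QFin) : QPre := by
  sorry

/-- **E2 [S]** the endgame is the LANDED `GoldenCuspShadowBaker.endgame_abstract` at
`ι = {(u,w) admissible}`, `y = log 13 + 2 log H`, `R = rad(uwQ)`, `m = rad Q` (`1 ≤ m ≤ R`): copy
`GoldenCuspShadowBaker.routeU_of_engine` (Theorems/CuspFieldPencilGoldenCuspShadow.lean:144) with `rad u ↦ rad Q`. -/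
theorem qSideRad_of_qPre (h : QPre) : QSideRad := by
  sorry

/-- **E3 [S]** payoff to the stub: landed `GoldenCuspShadowBaker.cuspMinRadBound_holds` (`log H ≤ κ R^ε m`,
`m = min(rad u, rad w)`) and `QSideRad` give `log H ≤ κ R^ε min(m, q) ≤ κ R^ε q^{2/3} m^{2/3}` (`min(m,q) ≤ m^{2/3}q^{1/3}
≤ m^{2/3}q^{2/3}`, `q ≥ 1`); pattern = k2-g7 `stub_of_uwHalf_qSideRad` / k2-g8 `sig_of_cuspMin_qSideRadSq` (PROVED there). -/
theorem sig_of_qSideRad (h : QSideRad) : Sig := by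
  sorry

/-- **E4 [S]** by-product: `min(m, q)³ ≤ rad u · rad w · rad Q = R` ⇒ `GoldenThird` (k2-g8 `goldenThird_of_qSideRad`, PROVED there). -/
theorem goldenThird_of_qSideRad (h : QSideRad) : GoldenThird := by
  sorry

/-- **K1 [M−]** archimedean half from the Matveev fact through the PROVED place bound (k2-g7 H5 / k3 Q4d–Q4). -/
theorem qArch_of_matveev (hM : matveev2000_linearFormsLog_nf) : QArch := by
  sorry

/-- **K2 [M−]** finite half from the Yu fact through the PROVED place bound and k2-g7's PROVED degree-one cost N1–N5. -/
theorem qFin_of_yu (hY : yu2007_padicLogForm_logB_nf) : QFin := by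
  sorry

/-! ## Assembly (kernel-checked composition modulo the helper bodies) -/

/-- `Sig` modulo {Matveev 2000, Yu 2007}: halves ⇒ pre-bound ⇒ landed endgame ⇒ Q-member bound ⇒ stub. -/
theorem sig_of_facts (hM : matveev2000_linearFormsLog_nf) (hY : yu2007_padicLogForm_logB_nf) : Sig :=
  sig_of_qSideRad (qSideRad_of_qPre (qPre_of_halves (qArch_of_matveev hM) (qFin_of_yu hY)))

/-- The by-product modulo the same two facts: exponent `1/3 + ε` on the 5-torsion cusp form. -/
theorem goldenThird_of_facts (hM : matveev2000_linearFormsLog_nf) (hY : yu2007_padicLogForm_logB_nf) :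
    GoldenThird :=
  goldenThird_of_qSideRad (qSideRad_of_qPre (qPre_of_halves (qArch_of_matveev hM) (qFin_of_yu hY)))

/-- Sanity: the verbatim stub text equals the registered signature's shape (elaboration check only). -/
example : Sig = (∀ ε : ℝ, 0 < ε → ∃ κ : ℝ, ∀ u w : ℤ, IsCoprime u w → u * w * (u ^ 2 - 11 * u * w - w ^ 2) ≠ 0 → Real.log (max (|(u : ℝ)|) (|(w : ℝ)|)) ≤ κ * (((UniqueFactorizationMonoid.radical (u * w * (u ^ 2 - 11 * u * w - w ^ 2))).natAbs : ℕ) : ℝ) ^ (ε : ℝ) * ((((UniqueFactorizationMonoid.radical (u ^ 2 - 11 * u * w - w ^ 2)).natAbs : ℕ) : ℝ) ^ (2 / 3 : ℝ) * (min (((UniqueFactorizationMonoid.radical u).natAbs : ℕ) : ℝ) (((UniqueFactorizationMonoid.radical w).natAbs : ℕ) : ℝ)) ^ (2 / 3 : ℝ))) := rfl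

/-- Tree-match sanity: the landed min-form and endgame are in scope BY NAME. -/
example := @Summit.ABC.ABC.Theorems.GoldenCuspShadowBaker.cuspMinRadBound_holds
example := @Summit.ABC.ABC.Theorems.GoldenCuspShadowBaker.endgame_abstract
example := @Summit.ABC.ABC.Theorems.GoldenCuspShadowBaker.routeU_of_engine
example := @Dioph.evertseGyory2022_prop_4_2_4_infinite_nf_of_matveev
example := @Dioph.evertseGyory2022_prop_4_2_4_finite_nf_of_yu
example := @Summit.ABC.ABC.Theorems.nfPencilBound_of_scoones2021
example := @Summit.ABC.ABC.Theorems.goldenCuspShadow_of_scoones2021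
example := @Summit.ABC.ABC.Theorems.goldenCuspShadow_proof
example := @Summit.ABC.ABC.Theorems.SingleTowerSzpiroLine.exists_prod_mul_log_div_rpow_le
example := @Literature.NumberTheory.DiophantineGeometry.exists_pow_card_primeFactors_le_mul_rpow
example := @Literature.NumberTheory.DiophantineGeometry.exists_prod_log_primeFactors_le_mul_rpow
example := @Literature.Barriers.ABC.log_eq_sum_factorization_mul_log
example := @Summit.ABC.ABC.Theorems.GoldenCuspShadowBaker.one_add_three_sum_le

end Summit.ABC.ABC.Cruxes.GoldenCuspShadow.SideaK1G9

end
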